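import Literature.RingTheory.FormalGroups.FormalOModuleBudCoeffVar
import Literature.RingTheory.FormalGroups.SymmetricCocycleLemma
import Literature.RingTheory.FormalGroups.DrinfeldCocycle
import HarnessLib

/-!
# Buds of formal `𝒪`-module laws, VI: from the degree-`m` relations to Lazard ∕ Drinfeld cocycles and back
# ([Lazard 1955] §II Lemme 3; [Drinfeld 1974] §1, proof of Prop. 1.4)

Topic `Literature/RingTheory/FormalGroups`; namespace `Literature.RingTheory.FormalGroups`.  One definition (the structure
`IsBudRelation`) + fully proved theorems; no named fact, no instance, no notation, no `sorry`.  Cell `hodgecm-mathlib`, P6 «MOD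
programme», sub-line P6d (power-series layer for `stub_L4B3cO`).

The degree-`m` coefficients of the variations of a bud (sibling `FormalOModuleBudCoeffVar`), pushed into any `𝒪`-module `N`
by an `𝒪`-linear map `g` (e.g. the identity of `B`, or the projection `Q → Q/P` of the descent step), give a system
`IsBudRelation 𝒪 m γ d` on `γ : ℕ → N`, `d : 𝒪 → N`:
  `IsSymmCocycle m γ`,  `C(m,j)·d a + (a − a^m)·γ_j = 0` (`0 < j < m`),
  `d(a+b) − d a − d b = Σ_j a^j b^{m−j}·γ_j`,  `d(ab) = a·d b + b^m·d a`.
* `isBudRelation_of_coeff_var` — the relations hold as soon as `g` kills the degree-`m` coefficients of the five variations.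
* `IsBudRelation.exists_isDrinfeldCocycle` — by LAZARD'S LEMMA (★ `IsSymmCocycle.exists_eq_cocycleCoeff_smul`) `γ = C_m • c`,
  and then `(c, d)` is a DRINFELD COCYCLE (★ `IsDrinfeldCocycle`; the factor `C(m,j) = ν(m)·c_{m,j}` is cancelled by
  primitivity ★ `eq_zero_of_cocycleCoeff_smul_eq_zero`).
* `IsDrinfeldCocycle.isBudRelation` — conversely a Drinfeld cocycle `(c, δ)` gives the relations for `(C_m • c, δ)`.
-/

noncomputable section

namespace Literature.RingTheory.FormalGroups

open MvPowerSeries (X order coeff)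
open Finset Finsupp

universe u v w

variable (𝒪 : Type u) [CommRing 𝒪]

/-! ## §1 The relations -/

/-- **The degree-`m` relations of a bud perturbation** with values in an `𝒪`-module `N` (`γ_j` = image of the coefficient
of `X₀^jX₁^{m−j}` of `Γ`, `d a` = image of the coefficient of `X^m` of `θ_a`): Lazard's symmetric 2-cocycle relations and
Drinfeld's three relations before division by `C_m`. [cite: Lazard1955, §II Lemme 3] [cite: Drinfeld1974, §1 Prop. 1.4 (proof)] -/
structure IsBudRelation (m : ℕ) {N : Type v} [AddCommGroup N] [Module 𝒪 N] (γ : ℕ → N) (d : 𝒪 → N) : Prop where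
  /-- associativity + commutativity: `γ` is a symmetric 2-cocycle -/
  cocycle : IsSymmCocycle m γ
  /-- `ρ_a ∘ F = F ∘ ρ_a`: `C(m,j)·d a + (a − a^m)·γ_j = 0` for `0 < j < m` -/
  hom : ∀ (a : 𝒪) (j : ℕ), 0 < j → j < m → m.choose j • d a + (a - a ^ m) • γ j = 0
  /-- `ρ_{a+b} = F(ρ_a, ρ_b)`: `d(a+b) − d a − d b = Σ_j a^j b^{m−j}·γ_j` -/
  add : ∀ a b : 𝒪, d (a + b) - d a - d b = ∑ j ∈ range (m + 1), (a ^ j * b ^ (m - j)) • γ j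
  /-- `ρ_{ab} = ρ_a ∘ ρ_b`: `d(ab) = a·d b + b^m·d a` -/
  mul : ∀ a b : 𝒪, d (a * b) = a • d b + b ^ m • d a

variable {𝒪}

/-! ## §2 From vanishing coefficients to the relations -/

section OfVar

variable {B : Type v} [CommRing B] [Algebra 𝒪 B] {N : Type w} [AddCommGroup N] [Module 𝒪 N]

/-- `g ((n : B) * x) = n • g x` and `g (algebraMap a * x) = a • g x` for an `𝒪`-linear `g`. [folklore] -/
private theorem map_natCast_mul (g : B →ₗ[𝒪] N) (n : ℕ) (x : B) : g ((n : B) * x) = n • g x := by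
  rw [← nsmul_eq_mul, map_nsmul]

/-- `g (algebraMap a * x) = a • g x` for an `𝒪`-linear `g`. [folklore] -/
private theorem map_algebraMap_mul (g : B →ₗ[𝒪] N) (a : 𝒪) (x : B) : g (algebraMap 𝒪 B a * x) = a • g x := by
  rw [← Algebra.smul_def, map_smul]

/-- **The relations from the coefficients.**  Let `Γ`, `θ_a` have order `≥ m` and let `g : B → N` be `𝒪`-linear, killing the
degree-`m` coefficients of `assocVar Γ`, `commDefect Γ`, `homVar a Γ θ_a`, `addVar`, `mulVar` (with `c_a = a·1_B`).  Then
`(g ∘ γ, g ∘ θ_m)` satisfies the bud relations in `N`. [cite: Lazard1955, §II Lemme 3] [cite: Drinfeld1974, §1 Prop. 1.4 (proof)] -/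
theorem isBudRelation_of_coeff_var {m : ℕ} {Γ : MvPowerSeries (Fin 2) B} (hΓ : (m : ℕ∞) ≤ Γ.order) {θ : 𝒪 → PowerSeries B}
    (hθ : ∀ a, (m : ℕ∞) ≤ MvPowerSeries.order (θ a)) (g : B →ₗ[𝒪] N)
    (hA : ∀ i j k, i + j + k = m → g (coeff (single 0 i + single 1 j + single 2 k) (assocVar Γ)) = 0)
    (hC : ∀ j, j ≤ m → g (coeff (single 0 j + single 1 (m - j)) (commDefect Γ)) = 0)
    (hH : ∀ (a : 𝒪) (j : ℕ), j ≤ m → g (coeff (single 0 j + single 1 (m - j)) (homVar (algebraMap 𝒪 B a) Γ (θ a))) = 0)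
    (hAdd : ∀ a b : 𝒪,
      g (PowerSeries.coeff m (addVar (algebraMap 𝒪 B a) (algebraMap 𝒪 B b) Γ (θ a) (θ b) (θ (a + b)))) = 0)
    (hMul : ∀ a b : 𝒪, g (PowerSeries.coeff m (mulVar (algebraMap 𝒪 B a) (algebraMap 𝒪 B b) (θ a) (θ b) (θ (a * b)))) = 0) :
    IsBudRelation 𝒪 m (fun j => g (degCoeff m Γ j)) (fun a => g (PowerSeries.coeff m (θ a))) where
  cocycle :=
    { eq_zero_of_lt := fun j hj => by simp [degCoeff_of_lt Γ hj]
      symm := fun j hj => by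
        have h := hC j hj
        rw [coeff_commDefect hΓ hj, map_sub, sub_eq_zero] at h
        exact h.symm
      cocycle := fun i j k hijk => by
        have h := hA i j k hijk
        rw [coeff_assocVar hΓ hijk, map_sub, map_sub, map_add, map_natCast_mul, map_natCast_mul] at h
        -- h : [k=0]γ_i + C(i+j,i)γ_{i+j} − [i=0]γ_j − C(j+k,j)γ_i = 0 (under `g`)
        have h' : g (if i = 0 then degCoeff m Γ j else 0) + (j + k).choose j • g (degCoeff m Γ i) =
            (i + j).choose i • g (degCoeff m Γ (i + j)) + g (if k = 0 then degCoeff m Γ i else 0) := by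
          rw [sub_sub, sub_eq_zero] at h
          rw [← h]; abel
        split_ifs at h' ⊢ <;> simpa using h' }
  hom := fun a j hj0 hjm => by
    have h := hH a j hjm.le
    rw [coeff_homVar hΓ (hθ a) _ hjm.le, if_neg hj0.ne', if_neg hjm.ne, sub_zero, sub_zero, map_add, map_natCast_mul,
      ← map_pow, ← map_sub, map_algebraMap_mul] at h
    exact h
  add := fun a b => by
    have h := hAdd a b
    rw [coeff_addVar hΓ, map_sub, map_sub, map_sub, map_sum, sub_eq_zero] at h
    rw [h]
    refine Finset.sum_congr rfl fun j _ => ?_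
    rw [← map_pow, ← map_pow, ← map_mul, map_algebraMap_mul]
  mul := fun a b => by
    have h := hMul a b
    rw [coeff_mulVar _ _ (hθ a), map_sub, map_sub, ← map_pow, map_algebraMap_mul, map_algebraMap_mul, sub_sub,
      sub_eq_zero] at h
    exact h

end OfVar

/-! ## §3 Relations versus Drinfeld cocycles -/

section Drinfeld

variable {N : Type v} [AddCommGroup N] [Module 𝒪 N] {m : ℕ}

/-- **From the relations to a Drinfeld cocycle** (`m ≥ 2`): by Lazard's symmetric 2-cocycle lemma `γ = C_m • c`, and then
`(c, d)` satisfies Drinfeld's relations — the factor `C(m,j) = ν(m)·c_{m,j}` of the `hom`-relation is removed by primitivity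
of `C_m`. [cite: Lazard1955, §II Lemme 3] [cite: Drinfeld1974, §1 Prop. 1.4 (proof)] -/
theorem IsBudRelation.exists_isDrinfeldCocycle {γ : ℕ → N} {d : 𝒪 → N} (h : IsBudRelation 𝒪 m γ d) (hm : 2 ≤ m) :
    ∃ c : N, (∀ j, γ j = cocycleCoeff m j • c) ∧ IsDrinfeldCocycle m c d := by
  obtain ⟨c, hc⟩ := h.cocycle.exists_eq_cocycleCoeff_smul hm
  refine ⟨c, hc, ⟨fun a => ?_, fun a b => ?_, fun a b => ?_⟩⟩
  · -- `ν·d a = (a^m − a)·c` from `c_{m,j}·(ν d a − (a^m−a) c) = 0` for all `0 < j < m`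
    have key : ∀ j, 0 < j → j < m → cocycleCoeff m j • (lazardNu m • d a - (a ^ m - a) • c) = 0 := by
      intro j hj0 hjm
      have h1 := h.hom a j hj0 hjm
      rw [hc j, ← lazardNu_mul_cocycleCoeff hj0 hjm, mul_comm, mul_smul] at h1
      rw [smul_sub, ← h1, smul_comm (a - a ^ m), ← neg_sub (a ^ m) a, neg_smul, smul_neg]
      abel
    exact sub_eq_zero.1 (eq_zero_of_cocycleCoeff_smul_eq_zero hm key)
  · have hadd := h.add a b
    rw [sub_sub, sub_eq_iff_eq_add'] at hadd
    rw [hadd, cocyclePolyEval, Finset.sum_smul]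
    congr 1
    refine Finset.sum_congr rfl fun j _ => ?_
    rw [hc j, ← Nat.cast_smul_eq_nsmul 𝒪 (cocycleCoeff m j), smul_smul]
    congr 1; ring
  · rw [h.mul a b, add_comm]

/-- **From a Drinfeld cocycle to the relations**: `(C_m • c, δ)` satisfies the bud relations (`m ≥ 1`).
[cite: Drinfeld1974, §1 Prop. 1.4 (proof)] -/
theorem IsDrinfeldCocycle.isBudRelation {c : N} {δ : 𝒪 → N} (h : IsDrinfeldCocycle m c δ) :
    IsBudRelation 𝒪 m (fun j => cocycleCoeff m j • c) δ where
  cocycle := isSymmCocycle_cocycleCoeff_smul m c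
  hom := fun a j hj0 hjm => by
    rw [← lazardNu_mul_cocycleCoeff hj0 hjm, mul_comm, mul_smul, h.nu_smul a, smul_comm (a - a ^ m), ← smul_add,
      ← add_smul, sub_add_sub_cancel', sub_self, zero_smul, smul_zero]
  add := fun a b => by
    rw [h.delta_add a b, show δ a + δ b + cocyclePolyEval 𝒪 m a b • c - δ a - δ b = cocyclePolyEval 𝒪 m a b • c by abel,
      cocyclePolyEval, Finset.sum_smul]
    refine Finset.sum_congr rfl fun j _ => ?_
    rw [← Nat.cast_smul_eq_nsmul 𝒪 (cocycleCoeff m j), smul_smul]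
    congr 1; ring
  mul := fun a b => by rw [h.delta_mul a b, add_comm]

end Drinfeld

end Literature.RingTheory.FormalGroups
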